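import Literature.NumberTheory.Sieve.MoebiusExpSumDavenport

/-!
# Route `GreenTaoLevelTwo`, crux `MNTwo` (stmt-Parity-21276), line `birth`, stub `stub_mnVertical`:
# Möbius is orthogonal to periodic sequences, linearly in the period (GT 2008b Prop. 7)

Brick for blocks V2/V5/V6 of the `stub_mnVertical` census (B. Green, T. Tao, *Quadratic uniformity of
the Möbius function*, Ann. Inst. Fourier 58 (2008) = arXiv:math/0606087, §3 Proposition 7 (mob-period):
"Möbius is orthogonal to periodic sequences … `𝔼_{n∈[N]} μ(n) f(n) ≪_A q ‖f‖_∞ log^{−A} N` for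
`q`-periodic `f`" — the major-arc input of Props. 12 and 15).  Here with a twist by a linear phase, from
the tree's Davenport estimate on arithmetic progressions (`MoebiusDavenport.davenport_progression`,
Siegel–Walfisz inside; constant ineffective).  Def-free:

* `sum_Icc_eq_sum_mod_sum_filter` — splitting `∑_{n ≤ N}` according to `n mod q`;
* `norm_sum_moebius_periodic_le` — `‖∑_{n ≤ N} μ(n) f(n) e(nα)‖ ≤ C_A · q · N / log^A N` for
  `q`-periodic `f : ℕ → ℂ` with `‖f‖ ≤ 1`.

References: [GreenTao2008QuadraticMobius] arXiv:math/0606087 §3, Proposition 7.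
-/

noncomputable section

open Finset Real ArithmeticFunction
open scoped FourierTransform ArithmeticFunction.Moebius

namespace Summit.Parity.GeneralizedHardyLittlewood.GreenTaoLevelTwoMNTwoMoebiusPeriodic

open Literature.NumberTheory.Sieve.Vinogradov (norm_fourierChar)
open Literature.NumberTheory.Sieve.MoebiusDavenport (davenport_progression)

/-- Splitting a sum over `[1, N]` by residues modulo `q ≥ 1`. [folklore] -/
theorem sum_Icc_eq_sum_mod_sum_filter {q : ℕ} (hq : 1 ≤ q) (N : ℕ) (G : ℕ → ℂ) :
    ∑ n ∈ Icc 1 N, G n = ∑ r ∈ range q, ∑ n ∈ (Icc 1 N).filter (fun n : ℕ => n % q = r), G n := by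
  rw [← Finset.sum_fiberwise_of_maps_to (s := Icc 1 N) (t := range q) (g := fun n : ℕ => n % q)
    (fun n _ => mem_range.2 (Nat.mod_lt n (by omega)))]

/-- **Möbius is orthogonal to periodic sequences (GT 2008b Prop. 7), with a linear twist.**  For every
`A > 0` there is `C` such that for all `N ≥ 2`, all `q ≥ 1`, all `q`-periodic `f : ℕ → ℂ` with
`‖f‖ ≤ 1` and all real `α`: `‖∑_{n ≤ N} μ(n) f(n) e(nα)‖ ≤ C · q · N / log^A N`.
[cite: GreenTao2008QuadraticMobius, Proposition 7] -/
theorem norm_sum_moebius_periodic_le {A : ℝ} (hA : 0 < A) :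
    ∃ C : ℝ, ∀ N : ℕ, 2 ≤ N → ∀ q : ℕ, 1 ≤ q → ∀ f : ℕ → ℂ, (∀ n, f (n + q) = f n) →
      (∀ n, ‖f n‖ ≤ 1) → ∀ α : ℝ,
        ‖∑ n ∈ Icc 1 N, ((μ n : ℝ) : ℂ) * f n * (𝐞 ((n : ℝ) * α) : ℂ)‖ ≤ C * q * N / Real.log N ^ A := by
  obtain ⟨C, hC⟩ := davenport_progression A hA
  refine ⟨max C 0, fun N hN q hq f hper hf1 α => ?_⟩
  have hNpos : (0 : ℝ) < N := by exact_mod_cast (show 0 < N by omega)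
  have hlog : 0 < Real.log N := Real.log_pos (by exact_mod_cast (show 1 < N by omega))
  have hLA : 0 < Real.log N ^ A := Real.rpow_pos_of_pos hlog A
  -- `f` is constant on each residue class: `f n = f (n % q)`
  have hmod : ∀ n, f n = f (n % q) := by
    intro n
    have key : ∀ m r : ℕ, f (r + q * m) = f r := by
      intro m
      induction m with
      | zero => intro r; simp
      | succ m ih => intro r; rw [Nat.mul_succ, ← add_assoc, hper, ih]
    conv_lhs => rw [← Nat.mod_add_div n q]
    exact key _ _
  rw [sum_Icc_eq_sum_mod_sum_filter hq]
  have hclass : ∀ r ∈ range q,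
      ‖∑ n ∈ (Icc 1 N).filter (fun n : ℕ => n % q = r), ((μ n : ℝ) : ℂ) * f n * (𝐞 ((n : ℝ) * α) : ℂ)‖ ≤
        max C 0 * N / Real.log N ^ A := by
    intro r _
    have e : ∑ n ∈ (Icc 1 N).filter (fun n : ℕ => n % q = r),
        ((μ n : ℝ) : ℂ) * f n * (𝐞 ((n : ℝ) * α) : ℂ) =
        f r * ∑ n ∈ (Icc 1 N).filter (fun n : ℕ => n % q = r),
          ((μ n : ℝ) : ℂ) * (𝐞 ((n : ℝ) * α) : ℂ) := by
      rw [Finset.mul_sum]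
      refine Finset.sum_congr rfl fun n hn => ?_
      rw [mem_filter] at hn
      rw [hmod n, hn.2]; ring
    rw [e, norm_mul]
    calc ‖f r‖ * ‖∑ n ∈ (Icc 1 N).filter (fun n : ℕ => n % q = r),
          ((μ n : ℝ) : ℂ) * (𝐞 ((n : ℝ) * α) : ℂ)‖ ≤ 1 * (C * N / Real.log N ^ A) :=
          mul_le_mul (hf1 r) (hC N hN q hq r α) (norm_nonneg _) zero_le_one
      _ ≤ max C 0 * N / Real.log N ^ A := by
          rw [one_mul, div_le_div_iff_of_pos_right hLA]
          exact mul_le_mul_of_nonneg_right (le_max_left _ _) hNpos.le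
  calc ‖∑ r ∈ range q, ∑ n ∈ (Icc 1 N).filter (fun n : ℕ => n % q = r),
        ((μ n : ℝ) : ℂ) * f n * (𝐞 ((n : ℝ) * α) : ℂ)‖
      ≤ ∑ r ∈ range q, ‖∑ n ∈ (Icc 1 N).filter (fun n : ℕ => n % q = r),
        ((μ n : ℝ) : ℂ) * f n * (𝐞 ((n : ℝ) * α) : ℂ)‖ := norm_sum_le _ _
    _ ≤ ∑ _r ∈ range q, max C 0 * N / Real.log N ^ A := Finset.sum_le_sum hclass
    _ = max C 0 * q * N / Real.log N ^ A := by
        rw [Finset.sum_const, card_range, nsmul_eq_mul]; ring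

end Summit.Parity.GeneralizedHardyLittlewood.GreenTaoLevelTwoMNTwoMoebiusPeriodic
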